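import Summits.HodgeConjecture.HodgeConjecture.Theorems.PadicSemiregularLiftFermatAnchorAssemblyEulerCochains
import Mathlib.Algebra.Order.Antidiag.Finsupp
import Mathlib.LinearAlgebra.Dimension.Constructions
import Mathlib.LinearAlgebra.FiniteDimensional.Defs

/-!
# The `ℤ`-graded Hom complex of a pair of graded matrix factorizations, II: coordinates (line `witt-lift-rigid-mf`)

Crux `FermatAnchorAssembly` (stmt-HodgeConjecture-14874), stub `stub_eulerBaseChange`; continues
`Theorems/PadicSemiregularLiftFermatAnchorAssemblyEulerCochains.lean`.

The cochain spaces of the Hom complex are spaces of pairs of polynomial matrices whose entries are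
bihomogeneous of prescribed bidegrees. This file proves that such a space is FREE ON A FINITE SET OF
MONOMIAL POSITIONS that depends only on the degree/character labels — so its dimension is the same
number over every coefficient field (the input "`dim C_t(M ⊗ 𝕜) = dim C_t(M ⊗ K)`" of the Euler-form
base-change invariance):

* `entryAt pos z` — the entry of a pair of matrices `z` at a position `pos : (α × β) ⊕ (γ × δ)`;
  `homogSub L Λ` — pairs whose entry at `pos` is bihomogeneous of bidegree `Λ pos` (an `A`-submodule);
  `admSet L Λ` — the admissible (position, exponent) pairs, a FINITE set (`admSet_finite`);
* `coordMap L Λ : homogSub L Λ →ₗ[A] (admSet L Λ → A)` (admissible coefficients) is a linear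
  ISOMORPHISM over any commutative ring `A` (`coordEquiv`); hence over a field
  `finrank (homogSub L Λ) = Nat.card (admSet L Λ)` and `homogSub` is finite-dimensional;
* `GMFData.evenLabel / oddLabel` — the bidegree labels of even / odd cochains of twist `t`;
  `cochainSub = homogSub (evenLabel t)`, `oddSub = homogSub (oddLabel t)`; the labels are unchanged by
  base change (`rfl`) and `evenLabel t M N.shift = oddLabel (t + m) M N`, `oddLabel t M N.shift = evenLabel t M N`
  (the vocabulary's "even cochains into `N[1]` are odd cochains into `N` of twist `t + m`");
* registered sub-goal `finrank_cochainSub_baseChange`: for data over `A` and two ring maps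
  `A → F`, `A → F'` to fields, the even cochain spaces of the two base changes have the same dimension.

All `[folklore]`; no named fact, no `sorry`.
-/

-- `Summit.HodgeConjecture.HodgeConjecture.…` is the tree's mandated summit/problem namespace (single-problem summit).
set_option linter.dupNamespace false

noncomputable section

open Finset

namespace Summit.HodgeConjecture.HodgeConjecture.Cruxes.FermatAnchorAssembly.WittLiftRigidMf

variable {ν m : ℕ}

/-! ### Exponents of a fixed degree form a finite set -/

/-- The exponents of `ℤ`-degree `d` form a finite set (a subset of a `finsuppAntidiag`). [folklore] -/
theorem finite_setOf_zdeg_eq (d : ℤ) : {e : Fin ν →₀ ℕ | zdeg e = d}.Finite := by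
  classical
  refine (Finset.finsuppAntidiag (Finset.univ : Finset (Fin ν)) d.toNat).finite_toSet.subset ?_
  intro e he
  have he' : ((Finset.univ.sum (⇑e) : ℕ) : ℤ) = d := he
  simp only [Finset.mem_coe, Finset.mem_finsuppAntidiag, Finset.subset_univ, and_true]
  omega

/-- `homogSet` is finite. [folklore] -/
theorem homogSet_finite (L : AddSubgroup (Fin ν → ZMod m)) (d : ℤ) (c : Fin ν → ZMod m) :
    (homogSet m L d c).Finite :=
  (finite_setOf_zdeg_eq d).subset fun _ he ↦ he.1

/-! ### Pairs of polynomial matrices with bihomogeneous entries of prescribed bidegrees -/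

section Generic

variable {A : Type} [CommRing A] {α β γ δ : Type}

/-- The entry of a pair of matrices at a position (`inl` = first matrix, `inr` = second). [folklore] -/
def entryAt : (α × β) ⊕ (γ × δ) →
    Matrix α β (MvPolynomial (Fin ν) A) × Matrix γ δ (MvPolynomial (Fin ν) A) → MvPolynomial (Fin ν) A
  | Sum.inl ab => fun z ↦ z.1 ab.1 ab.2
  | Sum.inr cd => fun z ↦ z.2 cd.1 cd.2

omit [CommRing A] in
/-- `entryAt` is additive. [folklore] -/
@[simp] theorem entryAt_add [CommRing A] (pos : (α × β) ⊕ (γ × δ))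
    (z z' : Matrix α β (MvPolynomial (Fin ν) A) × Matrix γ δ (MvPolynomial (Fin ν) A)) :
    entryAt pos (z + z') = entryAt pos z + entryAt pos z' := by
  cases pos <;> rfl

omit [CommRing A] in
/-- `entryAt` is homogeneous. [folklore] -/
@[simp] theorem entryAt_smul [CommRing A] {S : Type} [SMul S (MvPolynomial (Fin ν) A)]
    (pos : (α × β) ⊕ (γ × δ)) (c : S)
    (z : Matrix α β (MvPolynomial (Fin ν) A) × Matrix γ δ (MvPolynomial (Fin ν) A)) :
    entryAt pos (c • z) = c • entryAt pos z := by
  cases pos <;> rfl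

omit [CommRing A] in
/-- `entryAt` of zero. [folklore] -/
@[simp] theorem entryAt_zero [CommRing A] (pos : (α × β) ⊕ (γ × δ)) :
    entryAt pos (0 : Matrix α β (MvPolynomial (Fin ν) A) × Matrix γ δ (MvPolynomial (Fin ν) A)) = 0 := by
  cases pos <;> rfl

omit [CommRing A] in
/-- Two pairs of matrices with the same entries are equal. [folklore] -/
theorem ext_entryAt [CommRing A]
    {z z' : Matrix α β (MvPolynomial (Fin ν) A) × Matrix γ δ (MvPolynomial (Fin ν) A)}
    (h : ∀ pos, entryAt pos z = entryAt pos z') : z = z' :=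
  Prod.ext (Matrix.ext fun a b ↦ h (Sum.inl (a, b))) (Matrix.ext fun c d ↦ h (Sum.inr (c, d)))

/-- Pairs of polynomial matrices whose entry at `pos` is bihomogeneous of bidegree `Λ pos`, as an
`A`-submodule. [folklore] -/
def homogSub (L : AddSubgroup (Fin ν → ZMod m)) (Λ : (α × β) ⊕ (γ × δ) → ℤ × (Fin ν → ZMod m)) :
    Submodule A (Matrix α β (MvPolynomial (Fin ν) A) × Matrix γ δ (MvPolynomial (Fin ν) A)) where
  carrier := {z | ∀ pos, IsBihom m L (entryAt pos z) (Λ pos).1 (Λ pos).2}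
  zero_mem' pos := by rw [entryAt_zero]; exact IsBihom.zero
  add_mem' hx hy pos := by rw [entryAt_add]; exact (hx pos).add (hy pos)
  smul_mem' a _ hx pos := by rw [entryAt_smul]; exact (hx pos).smul a

/-- Membership in `homogSub`. [folklore] -/
theorem mem_homogSub {L : AddSubgroup (Fin ν → ZMod m)} {Λ : (α × β) ⊕ (γ × δ) → ℤ × (Fin ν → ZMod m)}
    {z : Matrix α β (MvPolynomial (Fin ν) A) × Matrix γ δ (MvPolynomial (Fin ν) A)} :
    z ∈ homogSub L Λ ↔ ∀ pos, IsBihom m L (entryAt pos z) (Λ pos).1 (Λ pos).2 := Iff.rfl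

/-- The ADMISSIBLE monomial positions: `(pos, e)` with `e` of bidegree `Λ pos`. [folklore] -/
def admSet (L : AddSubgroup (Fin ν → ZMod m)) (Λ : (α × β) ⊕ (γ × δ) → ℤ × (Fin ν → ZMod m)) :
    Set (((α × β) ⊕ (γ × δ)) × (Fin ν →₀ ℕ)) :=
  {q | q.2 ∈ homogSet m L (Λ q.1).1 (Λ q.1).2}

/-- Membership in `admSet`. [folklore] -/
theorem mem_admSet {L : AddSubgroup (Fin ν → ZMod m)} {Λ : (α × β) ⊕ (γ × δ) → ℤ × (Fin ν → ZMod m)}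
    {q : ((α × β) ⊕ (γ × δ)) × (Fin ν →₀ ℕ)} :
    q ∈ admSet L Λ ↔ q.2 ∈ homogSet m L (Λ q.1).1 (Λ q.1).2 := Iff.rfl

/-- The admissible set is finite when the position types are. [folklore] -/
theorem admSet_finite [Finite α] [Finite β] [Finite γ] [Finite δ] (L : AddSubgroup (Fin ν → ZMod m))
    (Λ : (α × β) ⊕ (γ × δ) → ℤ × (Fin ν → ZMod m)) : (admSet L Λ).Finite := by
  have : admSet L Λ ⊆ ⋃ pos : (α × β) ⊕ (γ × δ), (Prod.mk pos) '' homogSet m L (Λ pos).1 (Λ pos).2 := by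
    rintro ⟨pos, e⟩ hq
    exact Set.mem_iUnion.mpr ⟨pos, e, hq, rfl⟩
  exact (Set.finite_iUnion fun pos ↦ (homogSet_finite L _ _).image _).subset this

/-- Membership in `homogSub` coefficientwise: non-admissible coefficients vanish. [folklore] -/
theorem mem_homogSub_iff_coeff {L : AddSubgroup (Fin ν → ZMod m)}
    {Λ : (α × β) ⊕ (γ × δ) → ℤ × (Fin ν → ZMod m)}
    {z : Matrix α β (MvPolynomial (Fin ν) A) × Matrix γ δ (MvPolynomial (Fin ν) A)} :
    z ∈ homogSub L Λ ↔ ∀ pos e, (entryAt pos z).coeff e ≠ 0 → (pos, e) ∈ admSet L Λ := by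
  simp only [mem_homogSub, IsBihom, MvPolynomial.mem_support_iff, mem_admSet, mem_homogSet]

/-- The admissible coefficients of an element of `homogSub`, a linear map to functions on `admSet`. [folklore] -/
def coordMap (L : AddSubgroup (Fin ν → ZMod m)) (Λ : (α × β) ⊕ (γ × δ) → ℤ × (Fin ν → ZMod m)) :
    homogSub (A := A) L Λ →ₗ[A] (admSet L Λ → A) where
  toFun z q := (entryAt q.1.1 (z : _)).coeff q.1.2
  map_add' z z' := by
    funext q
    simp only [Submodule.coe_add, entryAt_add, MvPolynomial.coeff_add, Pi.add_apply]
  map_smul' a z := by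
    funext q
    simp only [Submodule.coe_smul, entryAt_smul, MvPolynomial.coeff_smul, RingHom.id_apply,
      Pi.smul_apply]

/-- Formula for `coordMap`. [folklore] -/
@[simp] theorem coordMap_apply (L : AddSubgroup (Fin ν → ZMod m))
    (Λ : (α × β) ⊕ (γ × δ) → ℤ × (Fin ν → ZMod m)) (z : homogSub (A := A) L Λ) (q : admSet L Λ) :
    coordMap L Λ z q = (entryAt q.1.1 (z : _)).coeff q.1.2 := rfl

/-- `coordMap` is injective: an element of `homogSub` is determined by its admissible coefficients
(the others vanish). [folklore] -/
theorem coordMap_injective (L : AddSubgroup (Fin ν → ZMod m))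
    (Λ : (α × β) ⊕ (γ × δ) → ℤ × (Fin ν → ZMod m)) :
    Function.Injective (coordMap (A := A) L Λ) := by
  intro z z' h
  apply Subtype.ext
  apply ext_entryAt
  intro pos
  apply MvPolynomial.ext
  intro e
  by_cases hq : (pos, e) ∈ admSet L Λ
  · exact congr_fun h ⟨(pos, e), hq⟩
  · have hz : (entryAt pos z.1).coeff e = (0 : A) := by
      by_contra hne
      exact hq (mem_homogSub_iff_coeff.mp z.2 pos e hne)
    have hz' : (entryAt pos z'.1).coeff e = (0 : A) := by
      by_contra hne
      exact hq (mem_homogSub_iff_coeff.mp z'.2 pos e hne)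
    change (entryAt pos z.1).coeff e = (entryAt pos z'.1).coeff e
    rw [hz, hz']

/-- The polynomial with prescribed (finitely supported) coefficients. [folklore] -/
def polyOfCoeff (f : (Fin ν →₀ ℕ) → A) (hf : (Function.support f).Finite) : MvPolynomial (Fin ν) A :=
  AddMonoidAlgebra.ofCoeff (Finsupp.ofSupportFinite f hf)

/-- Coefficients of `polyOfCoeff`. [folklore] -/
@[simp] theorem coeff_polyOfCoeff (f : (Fin ν →₀ ℕ) → A) (hf : (Function.support f).Finite)
    (e : Fin ν →₀ ℕ) : (polyOfCoeff f hf).coeff e = f e := by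
  simp [polyOfCoeff, MvPolynomial.coeff, Finsupp.ofSupportFinite_coe]

/-- `coordMap` is surjective: any admissible coefficient vector is realised (extend by zero). [folklore] -/
theorem coordMap_surjective [Finite α] [Finite β] [Finite γ] [Finite δ]
    (L : AddSubgroup (Fin ν → ZMod m)) (Λ : (α × β) ⊕ (γ × δ) → ℤ × (Fin ν → ZMod m)) :
    Function.Surjective (coordMap (A := A) L Λ) := by
  classical
  intro c
  -- extend `c` by zero to all (position, exponent) pairs
  let c' : ((α × β) ⊕ (γ × δ)) × (Fin ν →₀ ℕ) → A := fun q ↦ if h : q ∈ admSet L Λ then c ⟨q, h⟩ else 0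
  have hc' : ∀ q, c' q ≠ 0 → q ∈ admSet L Λ := by
    intro q hq
    by_contra h
    exact hq (by simp [c', h])  -- `h` closes the `dif`
  have hfin : ∀ pos, (Function.support fun e ↦ c' (pos, e)).Finite := by
    intro pos
    refine ((admSet_finite L Λ).preimage (f := fun e ↦ (pos, e)) ?_).subset ?_
    · exact (Prod.mk_right_injective pos).injOn
    · intro e he
      exact hc' _ he
  let P : (α × β) ⊕ (γ × δ) → MvPolynomial (Fin ν) A := fun pos ↦ polyOfCoeff _ (hfin pos)
  let z : Matrix α β (MvPolynomial (Fin ν) A) × Matrix γ δ (MvPolynomial (Fin ν) A) :=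
    (Matrix.of fun a b ↦ P (Sum.inl (a, b)), Matrix.of fun c d ↦ P (Sum.inr (c, d)))
  have hzP : ∀ pos, entryAt pos z = P pos := by
    rintro (⟨a, b⟩ | ⟨c, d⟩) <;> rfl
  have hz : z ∈ homogSub L Λ := by
    rw [mem_homogSub_iff_coeff]
    intro pos e he
    rw [hzP, coeff_polyOfCoeff] at he
    exact hc' _ he
  refine ⟨⟨z, hz⟩, funext fun q ↦ ?_⟩
  rw [coordMap_apply]
  change (entryAt q.1.1 z).coeff q.1.2 = c q
  rw [hzP, coeff_polyOfCoeff]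
  simp [c', q.2]

/-- **`homogSub L Λ` is free on the admissible set**: the coordinate isomorphism with functions on
`admSet L Λ`, over any commutative ring. [folklore] -/
def coordEquiv [Finite α] [Finite β] [Finite γ] [Finite δ] (L : AddSubgroup (Fin ν → ZMod m))
    (Λ : (α × β) ⊕ (γ × δ) → ℤ × (Fin ν → ZMod m)) :
    homogSub (A := A) L Λ ≃ₗ[A] (admSet L Λ → A) :=
  LinearEquiv.ofBijective (coordMap L Λ) ⟨coordMap_injective L Λ, coordMap_surjective L Λ⟩

end Generic

section Field

variable {F : Type} [Field F] {α β γ δ : Type} [Finite α] [Finite β] [Finite γ] [Finite δ]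

/-- Over a field, `homogSub L Λ` is finite-dimensional. [folklore] -/
instance homogSub_finite (L : AddSubgroup (Fin ν → ZMod m))
    (Λ : (α × β) ⊕ (γ × δ) → ℤ × (Fin ν → ZMod m)) : Module.Finite F (homogSub (A := F) L Λ) := by
  haveI : Finite (admSet L Λ) := (admSet_finite L Λ).to_subtype
  exact Module.Finite.equiv (coordEquiv (A := F) L Λ).symm

/-- **Over a field, `dim homogSub L Λ = #admSet L Λ`** — a number that depends only on the labels
`Λ`, not on the field. [folklore] -/
theorem finrank_homogSub (L : AddSubgroup (Fin ν → ZMod m))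
    (Λ : (α × β) ⊕ (γ × δ) → ℤ × (Fin ν → ZMod m)) :
    Module.finrank F (homogSub (A := F) L Λ) = Nat.card (admSet L Λ) := by
  haveI : Fintype (admSet L Λ) := (admSet_finite L Λ).fintype
  rw [(coordEquiv (A := F) L Λ).finrank_eq, Module.finrank_fintype_fun_eq_card, Nat.card_eq_fintype_card]

end Field

/-! ### The cochain spaces of the Hom complex are of this form -/

namespace GMFData

variable {A : Type} [CommRing A] {ι₀ ι₁ κ₀ κ₁ : Type}

/-- Bidegree labels of EVEN cochains of twist `t`: `a k i` has bidegree
`(d₀ᴹ i − d₀ᴺ k + t, c₀ᴹ i − c₀ᴺ k)`, `b l j` has `(d₁ᴹ j − d₁ᴺ l + t, c₁ᴹ j − c₁ᴺ l)`. [folklore] -/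
def evenLabel (t : ℤ) (M : GMFData A ν m ι₀ ι₁) (N : GMFData A ν m κ₀ κ₁) :
    (κ₀ × ι₀) ⊕ (κ₁ × ι₁) → ℤ × (Fin ν → ZMod m)
  | Sum.inl ki => (M.d₀ ki.2 - N.d₀ ki.1 + t, M.c₀ ki.2 - N.c₀ ki.1)
  | Sum.inr lj => (M.d₁ lj.2 - N.d₁ lj.1 + t, M.c₁ lj.2 - N.c₁ lj.1)

/-- Bidegree labels of ODD cochains of twist `t`: `s l i` has bidegree
`(d₀ᴹ i − d₁ᴺ l + t, c₀ᴹ i − c₁ᴺ l)`, `u k j` has `(d₁ᴹ j − m − d₀ᴺ k + t, c₁ᴹ j − c₀ᴺ k)`. [folklore] -/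
def oddLabel (t : ℤ) (M : GMFData A ν m ι₀ ι₁) (N : GMFData A ν m κ₀ κ₁) :
    (κ₁ × ι₀) ⊕ (κ₀ × ι₁) → ℤ × (Fin ν → ZMod m)
  | Sum.inl li => (M.d₀ li.2 - N.d₁ li.1 + t, M.c₀ li.2 - N.c₁ li.1)
  | Sum.inr kj => (M.d₁ kj.2 - m - N.d₀ kj.1 + t, M.c₁ kj.2 - N.c₀ kj.1)

/-- `cochainSub = homogSub (evenLabel t)`. [folklore] -/
theorem cochainSub_eq_homogSub (L : AddSubgroup (Fin ν → ZMod m)) (t : ℤ) (M : GMFData A ν m ι₀ ι₁)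
    (N : GMFData A ν m κ₀ κ₁) : cochainSub L t M N = homogSub L (evenLabel t M N) := by
  ext z
  rw [mem_cochainSub, mem_homogSub]
  constructor
  · rintro ⟨ha, hb⟩ (⟨k, i⟩ | ⟨l, j⟩)
    · exact ha k i
    · exact hb l j
  · intro h
    exact ⟨fun k i ↦ h (Sum.inl (k, i)), fun l j ↦ h (Sum.inr (l, j))⟩

/-- `oddSub = homogSub (oddLabel t)`. [folklore] -/
theorem oddSub_eq_homogSub (L : AddSubgroup (Fin ν → ZMod m)) (t : ℤ) (M : GMFData A ν m ι₀ ι₁)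
    (N : GMFData A ν m κ₀ κ₁) : oddSub L t M N = homogSub L (oddLabel t M N) := by
  ext z
  rw [mem_oddSub, mem_homogSub]
  constructor
  · rintro ⟨hs, hu⟩ (⟨l, i⟩ | ⟨k, j⟩)
    · exact hs l i
    · exact hu k j
  · intro h
    exact ⟨fun l i ↦ h (Sum.inl (l, i)), fun k j ↦ h (Sum.inr (k, j))⟩

/-- Labels are unchanged by base change. [folklore] -/
theorem evenLabel_map {S : Type} [CommRing S] (g : A →+* S) (t : ℤ) (M : GMFData A ν m ι₀ ι₁)
    (N : GMFData A ν m κ₀ κ₁) : evenLabel t (M.map g) (N.map g) = evenLabel t M N := by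
  funext pos; cases pos <;> rfl

/-- Labels are unchanged by base change. [folklore] -/
theorem oddLabel_map {S : Type} [CommRing S] (g : A →+* S) (t : ℤ) (M : GMFData A ν m ι₀ ι₁)
    (N : GMFData A ν m κ₀ κ₁) : oddLabel t (M.map g) (N.map g) = oddLabel t M N := by
  funext pos; cases pos <;> rfl

/-- Even cochains into the shift `N[1]` are the odd cochains into `N` of twist `t + m` (same labels). [folklore] -/
theorem evenLabel_shift (t : ℤ) (M : GMFData A ν m ι₀ ι₁) (N : GMFData A ν m κ₀ κ₁) :
    evenLabel t M N.shift = oddLabel (t + m) M N := by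
  funext pos
  rcases pos with ⟨l, i⟩ | ⟨k, j⟩
  · change (M.d₀ i - (N.d₁ l - m) + t, M.c₀ i - N.c₁ l) = (M.d₀ i - N.d₁ l + (t + m), M.c₀ i - N.c₁ l)
    refine Prod.ext ?_ rfl
    change M.d₀ i - (N.d₁ l - m) + t = M.d₀ i - N.d₁ l + (t + m)
    ring
  · change (M.d₁ j - N.d₀ k + t, M.c₁ j - N.c₀ k) = (M.d₁ j - m - N.d₀ k + (t + m), M.c₁ j - N.c₀ k)
    refine Prod.ext ?_ rfl
    change M.d₁ j - N.d₀ k + t = M.d₁ j - m - N.d₀ k + (t + m)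
    ring

/-- Odd cochains into the shift `N[1]` of twist `t` are the even cochains into `N` of twist `t`. [folklore] -/
theorem oddLabel_shift (t : ℤ) (M : GMFData A ν m ι₀ ι₁) (N : GMFData A ν m κ₀ κ₁) :
    oddLabel t M N.shift = evenLabel t M N := by
  funext pos
  rcases pos with ⟨k, i⟩ | ⟨l, j⟩
  · rfl
  · change (M.d₁ j - m - (N.d₁ l - m) + t, M.c₁ j - N.c₁ l) = (M.d₁ j - N.d₁ l + t, M.c₁ j - N.c₁ l)
    refine Prod.ext ?_ rfl
    change M.d₁ j - m - (N.d₁ l - m) + t = M.d₁ j - N.d₁ l + t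
    ring

/-- `cochainSub t M N[1] = oddSub (t + m) M N`. [folklore] -/
theorem cochainSub_shift (L : AddSubgroup (Fin ν → ZMod m)) (t : ℤ) (M : GMFData A ν m ι₀ ι₁)
    (N : GMFData A ν m κ₀ κ₁) : cochainSub L t M N.shift = oddSub L (t + m) M N := by
  rw [cochainSub_eq_homogSub, oddSub_eq_homogSub, evenLabel_shift]

/-- `oddSub t M N[1] = cochainSub t M N`. [folklore] -/
theorem oddSub_shift (L : AddSubgroup (Fin ν → ZMod m)) (t : ℤ) (M : GMFData A ν m ι₀ ι₁)
    (N : GMFData A ν m κ₀ κ₁) : oddSub L t M N.shift = cochainSub L t M N := by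
  rw [cochainSub_eq_homogSub, oddSub_eq_homogSub, oddLabel_shift]

variable {F : Type} [Field F] [Finite ι₀] [Finite ι₁] [Finite κ₀] [Finite κ₁]

/-- Even cochains of twist `t` over a field are finite-dimensional. [folklore] -/
instance cochainSub_finite (L : AddSubgroup (Fin ν → ZMod m)) (t : ℤ) (M : GMFData F ν m ι₀ ι₁)
    (N : GMFData F ν m κ₀ κ₁) : Module.Finite F (cochainSub L t M N) := by
  rw [cochainSub_eq_homogSub]; infer_instance

/-- Odd cochains of twist `t` over a field are finite-dimensional. [folklore] -/
instance oddSub_finite (L : AddSubgroup (Fin ν → ZMod m)) (t : ℤ) (M : GMFData F ν m ι₀ ι₁)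
    (N : GMFData F ν m κ₀ κ₁) : Module.Finite F (oddSub L t M N) := by
  rw [oddSub_eq_homogSub]; infer_instance

/-- `dim cochainSub t = #admSet (evenLabel t)`. [folklore] -/
theorem finrank_cochainSub (L : AddSubgroup (Fin ν → ZMod m)) (t : ℤ) (M : GMFData F ν m ι₀ ι₁)
    (N : GMFData F ν m κ₀ κ₁) :
    Module.finrank F (cochainSub L t M N) = Nat.card (admSet L (evenLabel t M N)) := by
  rw [cochainSub_eq_homogSub, finrank_homogSub]

/-- `dim oddSub t = #admSet (oddLabel t)`. [folklore] -/
theorem finrank_oddSub (L : AddSubgroup (Fin ν → ZMod m)) (t : ℤ) (M : GMFData F ν m ι₀ ι₁)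
    (N : GMFData F ν m κ₀ κ₁) :
    Module.finrank F (oddSub L t M N) = Nat.card (admSet L (oddLabel t M N)) := by
  rw [oddSub_eq_homogSub, finrank_homogSub]

end GMFData

/-- **Registered sub-goal: the dimension of the space of even cochains of twist `t` between two base
changes `M ⊗ F`, `N ⊗ F` of data over `A` does not depend on the field `F`** (it is the number of
admissible monomial positions, a function of the labels only). [folklore] -/
theorem finrank_cochainSub_baseChange : ∀ (A F F' : Type) [CommRing A] [Field F] [Field F']
    (g : A →+* F) (g' : A →+* F') (ν m : ℕ) (L : AddSubgroup (Fin ν → ZMod m)) (ι₀ ι₁ κ₀ κ₁ : Type)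
    [Finite ι₀] [Finite ι₁] [Finite κ₀] [Finite κ₁] (t : ℤ) (M : GMFData A ν m ι₀ ι₁)
    (N : GMFData A ν m κ₀ κ₁),
    Module.finrank F (GMFData.cochainSub L t (M.map g) (N.map g)) =
      Module.finrank F' (GMFData.cochainSub L t (M.map g') (N.map g')) := by
  intro A F F' _ _ _ g g' ν m L ι₀ ι₁ κ₀ κ₁ _ _ _ _ t M N
  rw [GMFData.finrank_cochainSub, GMFData.finrank_cochainSub, GMFData.evenLabel_map,
    GMFData.evenLabel_map]

/-- The odd analogue of `finrank_cochainSub_baseChange`. [folklore] -/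
theorem finrank_oddSub_baseChange : ∀ (A F F' : Type) [CommRing A] [Field F] [Field F']
    (g : A →+* F) (g' : A →+* F') (ν m : ℕ) (L : AddSubgroup (Fin ν → ZMod m)) (ι₀ ι₁ κ₀ κ₁ : Type)
    [Finite ι₀] [Finite ι₁] [Finite κ₀] [Finite κ₁] (t : ℤ) (M : GMFData A ν m ι₀ ι₁)
    (N : GMFData A ν m κ₀ κ₁),
    Module.finrank F (GMFData.oddSub L t (M.map g) (N.map g)) =
      Module.finrank F' (GMFData.oddSub L t (M.map g') (N.map g')) := by
  intro A F F' _ _ _ g g' ν m L ι₀ ι₁ κ₀ κ₁ _ _ _ _ t M N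
  rw [GMFData.finrank_oddSub, GMFData.finrank_oddSub, GMFData.oddLabel_map, GMFData.oddLabel_map]

end Summit.HodgeConjecture.HodgeConjecture.Cruxes.FermatAnchorAssembly.WittLiftRigidMf

end
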